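import Mathlib
import Literature.Analysis.Complex.HolomorphicParametricIntegral
import Literature.MathematicalPhysics.QuantumFieldTheory.OSReconstructionNoE1Proofs
import HarnessLib
import Summits.QuantumFields.YangMills.Theorems.MirrorModularBoostsPlanarSpectralConeDiscSections

/-!
# Stub `stub_transfer` — TRANSFER `C⁺ ⇒ C` (crux `PlanarSpectralCone`)

Line `positivity-disc-to-operator-cone` of crux `MirrorModularBoosts.PlanarSpectralCone`
(stmt-QuantumFields-9664), stub 5, with its helpers (the abstract contraction family, sub-namespace
`Contraction`, ported from `Cruxes/PlanarSpectralCone/DrefuteG4Contraction.lean`, drefute gen 4).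

Informal statement. Let `S` be a one-species Schwinger family on `ℝ⁴` and `h` an Osterwalder–Schrader
reconstruction (no E1) of `S.toLabelled` (Hilbert space `ℋ`, field vectors `Ψ_F = h.fieldVec`,
`e^{-tH} = h.transfer t`, `U(a⃗) = h.translate a`). If every joint spectral measure of every vector of
`ℋ` is carried by the closed planar cone `{|p₁| ≤ p₀}` (the operator cone `C⁺`), then for time-ordered
`F` (`n` points) and `G` (`m` points) there is `Φ : ℂ × ℂ → ℂ` holomorphic on the tube
`D = {(ζ, β) : |Im β| < Re ζ}` with `Φ(t, b) = 𝔖_{n+m}(ΘF* ⊗ G_{t e₀ + b e₁})` for `t > 0`, `b ∈ ℝ`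
(any tensor witness), and `‖Φ(ζ, β)‖² ≤ ‖𝔖_{2n}(ΘF* ⊗ F)‖ ‖𝔖_{2m}(ΘG* ⊗ G)‖` on `D`.

Proof. ABSTRACT HALF (`Contraction.contractionFamily`): for `ψ, ψ' ∈ ℋ` let `μ'` be a joint spectral
measure of `ψ'` (`exists_isJointSpectralMeasure_holds`; finite, carried by `{p₀ ≥ 0}` and — by `C⁺` —
by the closed cone). For `t ≥ 0`, `b ∈ ℝ` put `e_{t,b}(p) = e^{−tp₀ + ibp₁} ∈ L²(μ')` and
`V_{t,b} = e^{-tH} U(b e₁) ψ'`. The Gram identity `⟪e_{t,b}, e_{t',b'}⟫_{L²} = ⟪V_{t,b}, V_{t',b'}⟫_ℋ`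
(self-adjointness of `e^{-tH}`, semigroup law, unitarity and commutation of `U`, and
`IsJointSpectralMeasure.inner_transfer_translate`) makes `∑ cᵢ e_{tᵢ,bᵢ} ↦ ⟪ψ, ∑ cᵢ V_{tᵢ,bᵢ}⟫` well
defined on `span{e_{t,b}} ⊆ L²(μ')` and bounded by `‖ψ‖` (first isomorphism theorem); Hahn–Banach
(`exists_extension_norm_eq`) and Riesz (`InnerProductSpace.toDual`) give `g ∈ L²(μ')`, `‖g‖ ≤ ‖ψ‖`,
`⟪g, e_{t,b}⟫ = ⟪ψ, V_{t,b}⟫`. Then `Φ(ζ, β) := ∫ conj(g) e^{−ζp₀ + iβp₁} dμ'` is holomorphic on `D`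
(dominated holomorphic parameter integral, `differentiableOn_integral_of_dominated`: the kernel has
modulus `≤ 1` on the cone), equals `⟪ψ, V_{t,b}⟫` at real points, and `|Φ| ≤ ‖g‖ ‖e_w‖ ≤ ‖ψ‖ ‖ψ'‖`
(`μ'(univ) = ‖ψ'‖²`). READ-BACK (`stub_transfer`): take `ψ = Ψ_F`, `ψ' = Ψ_G`; at a real point
`e^{-tH} U(b e₁) Ψ_G = Ψ_{G_{t e₀ + b e₁}}` (`translate_fieldVec`, `transfer_fieldVec`,
`translateMulti_time_space`) and `⟪Ψ_F, Ψ_{G'}⟫ = 𝔖_{n+m}(H)` for every witness `H` of `ΘF* ⊗ G'`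
(`inner_fieldVec_fieldVec`); for the bound, `‖𝔖_{2k}(H_A)‖ = ‖Ψ_A‖²` for every witness `H_A` of
`ΘA* ⊗ A`, so `‖Φ‖² ≤ (‖Ψ_F‖ ‖Ψ_G‖)² = ‖𝔖_{2n}(H_F)‖ ‖𝔖_{2m}(H_G)‖`. No degenerate case is special.
-/

noncomputable section

namespace Summit.QuantumFields.YangMills.Cruxes.PlanarSpectralCone.PositivityDiscToOperatorCone

open MeasureTheory
open scoped InnerProductSpace SchwartzMap
open Literature.MathematicalPhysics.QuantumLattice Literature.MathematicalPhysics.AQFT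
  Literature.MathematicalPhysics.QuantumFieldTheory

/-- Euclidean `ℝ⁴`, time = coordinate `0`, the boost plane = coordinates `0, 1`. -/
local notation "E4" => EuclideanSpace ℝ (Fin 4)

namespace Contraction

open Complex Set Filter Topology
open scoped ComplexConjugate NNReal ENNReal

/-- `conj(e_{t,b}) · e_{t',b'} = e_{t+t', b'−b}` pointwise. -/
theorem conj_rKernel_mul_rKernel (t b t' b' : ℝ) (p : EuclideanSpace ℝ (Fin 4)) :
    conj (cexp ((((-(t * p 0)) : ℝ) : ℂ) + (((b * p 1) : ℝ) : ℂ) * I)) *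
        cexp ((((-(t' * p 0)) : ℝ) : ℂ) + (((b' * p 1) : ℝ) : ℂ) * I) =
      cexp ((((-((t + t') * p 0)) : ℝ) : ℂ) + ((((b' - b) * p 1) : ℝ) : ℂ) * I) := by
  rw [← Complex.exp_conj, ← Complex.exp_add]; congr 1
  simp only [map_add, map_mul, Complex.conj_ofReal, Complex.conj_I]; push_cast; ring

/-- `|e_{t,b}(p)| = e^{-tp₀}`. -/
theorem norm_rKernel (t b : ℝ) (p : EuclideanSpace ℝ (Fin 4)) :
    ‖cexp ((((-(t * p 0)) : ℝ) : ℂ) + (((b * p 1) : ℝ) : ℂ) * I)‖ = Real.exp (-(t * p 0)) := by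
  rw [Complex.norm_exp]; congr 1; simp

/-- `|e_{t,b}(p)| ≤ 1` for `t ≥ 0` and `p₀ ≥ 0`. -/
theorem norm_rKernel_le_one {t : ℝ} (ht : 0 ≤ t) (b : ℝ) {p : EuclideanSpace ℝ (Fin 4)}
    (hp : 0 ≤ p 0) : ‖cexp ((((-(t * p 0)) : ℝ) : ℂ) + (((b * p 1) : ℝ) : ℂ) * I)‖ ≤ 1 := by
  rw [norm_rKernel, Real.exp_le_one_iff, neg_nonpos]
  exact mul_nonneg ht hp

/-- `|e^{−ζp₀ + iβp₁}| = e^{−Re ζ p₀ − Im β p₁}`. -/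
theorem norm_cKernel (w : ℂ × ℂ) (p : EuclideanSpace ℝ (Fin 4)) :
    ‖cexp (-(w.1 * ((p 0 : ℝ) : ℂ)) + w.2 * ((p 1 : ℝ) : ℂ) * I)‖ =
      Real.exp (-(w.1.re * p 0) - w.2.im * p 1) := by
  rw [Complex.norm_exp]
  congr 1
  simp only [Complex.add_re, Complex.neg_re, Complex.mul_re, Complex.ofReal_re, Complex.ofReal_im,
    Complex.I_re, Complex.I_im, Complex.mul_im]
  ring

/-- `|e^{−ζp₀ + iβp₁}| ≤ 1` on the closed tube `|Im β| ≤ Re ζ` over the closed cone `|p₁| ≤ p₀`. -/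
theorem norm_cKernel_le_one {w : ℂ × ℂ} (hw : |w.2.im| ≤ w.1.re) {p : EuclideanSpace ℝ (Fin 4)}
    (hp0 : 0 ≤ p 0) (hp1 : |p 1| ≤ p 0) :
    ‖cexp (-(w.1 * ((p 0 : ℝ) : ℂ)) + w.2 * ((p 1 : ℝ) : ℂ) * I)‖ ≤ 1 := by
  rw [norm_cKernel, Real.exp_le_one_iff]
  have h1 : -(|w.2.im| * |p 1|) ≤ w.2.im * p 1 := by
    rw [← abs_mul]; exact neg_abs_le _
  have h2 : |w.2.im| * |p 1| ≤ |w.2.im| * p 0 := mul_le_mul_of_nonneg_left hp1 (abs_nonneg _)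
  have h3 : |w.2.im| * p 0 ≤ w.1.re * p 0 := mul_le_mul_of_nonneg_right hw hp0
  linarith

/-- At a real point `(t, b)` the complex kernel is the real kernel `e_{t,b}`. -/
theorem cKernel_ofReal (t b : ℝ) (p : EuclideanSpace ℝ (Fin 4)) :
    cexp (-(((t : ℂ), (b : ℂ)).1 * ((p 0 : ℝ) : ℂ)) + ((t : ℂ), (b : ℂ)).2 * ((p 1 : ℝ) : ℂ) * I) =
      cexp ((((-(t * p 0)) : ℝ) : ℂ) + (((b * p 1) : ℝ) : ℂ) * I) := by
  congr 1; push_cast; ring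

/-- The real kernel `p ↦ e_{t,b}(p)` is continuous. -/
theorem continuous_rKernel (t b : ℝ) :
    Continuous fun p : EuclideanSpace ℝ (Fin 4) =>
      cexp ((((-(t * p 0)) : ℝ) : ℂ) + (((b * p 1) : ℝ) : ℂ) * I) := by
  fun_prop

/-- The complex kernel `p ↦ e^{−ζp₀ + iβp₁}` is continuous. -/
theorem continuous_cKernel (w : ℂ × ℂ) :
    Continuous fun p : EuclideanSpace ℝ (Fin 4) =>
      cexp (-(w.1 * ((p 0 : ℝ) : ℂ)) + w.2 * ((p 1 : ℝ) : ℂ) * I) := by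
  fun_prop

/-- The complex kernel is entire in the parameter `w = (ζ, β) ∈ ℂ × ℂ`. -/
theorem differentiable_cKernel (c : ℂ) (p : EuclideanSpace ℝ (Fin 4)) :
    Differentiable ℂ fun w : ℂ × ℂ =>
      c * cexp (-(w.1 * ((p 0 : ℝ) : ℂ)) + w.2 * ((p 1 : ℝ) : ℂ) * I) := by
  fun_prop

/-- `⟪c e₁, p⟫ = c p₁`. -/
theorem inner_smul_single_one' (c : ℝ) (p : EuclideanSpace ℝ (Fin 4)) :
    ⟪(c • EuclideanSpace.single 1 1 : EuclideanSpace ℝ (Fin 4)), p⟫_ℝ = c * p 1 := by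
  simp [inner_smul_left, EuclideanSpace.inner_single_left]

/-- The domain `D = {|Im β| < Re ζ}` is open. -/
theorem isOpen_coneDomain : IsOpen {w : ℂ × ℂ | |w.2.im| < w.1.re} :=
  isOpen_lt (continuous_abs.comp (Complex.continuous_im.comp continuous_snd))
    (Complex.continuous_re.comp continuous_fst)

/-- Finite double sums `∑ᵢⱼ c̄ᵢ cⱼ ⟪uᵢ, uⱼ⟫` are `⟪∑ cᵢuᵢ, ∑ cᵢuᵢ⟫`. -/
theorem sum_sum_conj_mul_inner' {H : Type*} [NormedAddCommGroup H] [InnerProductSpace ℂ H]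
    {ι : Type*} (s : Finset ι) (c : ι → ℂ) (u : ι → H) :
    ∑ a ∈ s, ∑ b ∈ s, conj (c a) * c b * ⟪u a, u b⟫_ℂ =
      ⟪∑ a ∈ s, c a • u a, ∑ a ∈ s, c a • u a⟫_ℂ := by
  simp_rw [sum_inner, inner_sum, inner_smul_left, inner_smul_right]
  refine Finset.sum_congr rfl fun a _ => Finset.sum_congr rfl fun b _ => by ring

/-- `⟪e^{-tH}U(be₁)ψ', e^{-t'H}U(b'e₁)ψ'⟫ = ∫ e^{−(t+t')p₀ + i(b'−b)p₁} dμ'` for a joint spectral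
measure `μ'` of `ψ'`. -/
theorem inner_transferTranslate_transferTranslate
    {ι : Type} {T : LabelledSchwingerFamily ι (EuclideanSpace ℝ (Fin 4))} (h : OSReconstructionNoE1 T)
    {ψ' : h.Hilbert} {μ' : Measure (EuclideanSpace ℝ (Fin 4))} (hμ' : h.IsJointSpectralMeasure ψ' μ')
    {t t' : ℝ} (ht : 0 ≤ t) (ht' : 0 ≤ t') (b b' : ℝ) :
    ⟪h.transfer t (h.translate (b • EuclideanSpace.single 1 1) ψ'),
        h.transfer t' (h.translate (b' • EuclideanSpace.single 1 1) ψ')⟫_ℂ =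
      ∫ p, cexp ((((-((t + t') * p 0)) : ℝ) : ℂ) + ((((b' - b) * p 1) : ℝ) : ℂ) * I) ∂μ' := by
  have hU : ∀ (a : EuclideanSpace ℝ (Fin 4)) (φ χ : h.Hilbert),
      ⟪h.translate a φ, χ⟫_ℂ = ⟪φ, h.translate (-a) χ⟫_ℂ := by
    intro a φ χ
    have hχ : χ = h.translate a (h.translate (-a) χ) := by
      rw [← h.translate_add_apply, add_neg_cancel, h.translate_zero_apply]
    conv_lhs => rw [hχ]
    exact (h.translate a).inner_map_map φ _
  have hvec : -(b • EuclideanSpace.single 1 1 : EuclideanSpace ℝ (Fin 4)) +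
      b' • EuclideanSpace.single 1 1 = (b' - b) • EuclideanSpace.single 1 1 := by
    rw [sub_smul, ← neg_add_eq_sub]
  calc ⟪h.transfer t (h.translate (b • EuclideanSpace.single 1 1) ψ'),
        h.transfer t' (h.translate (b' • EuclideanSpace.single 1 1) ψ')⟫_ℂ
      = ⟪h.translate (b • EuclideanSpace.single 1 1) ψ',
          h.transfer t (h.transfer t' (h.translate (b' • EuclideanSpace.single 1 1) ψ'))⟫_ℂ :=
        h.inner_transfer_left t _ _
    _ = ⟪h.translate (b • EuclideanSpace.single 1 1) ψ',
          h.transfer (t + t') (h.translate (b' • EuclideanSpace.single 1 1) ψ')⟫_ℂ := by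
        rw [h.transfer_add ht ht', ContinuousLinearMap.comp_apply]
    _ = ⟪ψ', h.translate (-(b • EuclideanSpace.single 1 1))
          (h.transfer (t + t') (h.translate (b' • EuclideanSpace.single 1 1) ψ'))⟫_ℂ := hU _ _ _
    _ = ⟪ψ', h.transfer (t + t') (h.translate ((b' - b) • EuclideanSpace.single 1 1) ψ')⟫_ℂ := by
        rw [h.translate_transfer, ← h.translate_add_apply, hvec]
    _ = ∫ p, cexp ((((-((t + t') * p 0)) : ℝ) : ℂ) + ((((b' - b) * p 1) : ℝ) : ℂ) * I) ∂μ' := by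
        rw [hμ'.inner_transfer_translate (t + t') (add_nonneg ht ht') _ (by simp)]
        simp_rw [inner_smul_single_one']

/-- **TRANSFER `C⁺ ⇒ C` — the holomorphic contraction family on the operator cone.** If every joint
spectral measure of every vector of the OS space `h` is carried by the closed planar cone
`{|p₁| ≤ p₀}`, then for all `ψ, ψ'` there is `Φ` holomorphic on `{|Im β| < Re ζ}` with
`Φ(t, b) = ⟪ψ, e^{-tH} U(b e₁) ψ'⟫` (`t > 0`, `b ∈ ℝ`) and `‖Φ‖ ≤ ‖ψ‖ ‖ψ'‖` there. -/
theorem contractionFamily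
    {ι : Type} {T : LabelledSchwingerFamily ι (EuclideanSpace ℝ (Fin 4))} (h : OSReconstructionNoE1 T)
    (hcone : ∀ (ψ : h.Hilbert) (μ : Measure (EuclideanSpace ℝ (Fin 4))), h.IsJointSpectralMeasure ψ μ →
      μ {p | p 0 < |p 1|} = 0)
    (ψ ψ' : h.Hilbert) :
    ∃ Φ : ℂ × ℂ → ℂ, DifferentiableOn ℂ Φ {w : ℂ × ℂ | |w.2.im| < w.1.re} ∧
      (∀ t b : ℝ, 0 < t → Φ ((t : ℂ), (b : ℂ)) =
        ⟪ψ, h.transfer t (h.translate (b • EuclideanSpace.single 1 1) ψ')⟫_ℂ) ∧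
      ∀ w ∈ {w : ℂ × ℂ | |w.2.im| < w.1.re}, ‖Φ w‖ ≤ ‖ψ‖ * ‖ψ'‖ := by
  classical
  -- the joint spectral measure of `ψ'`: finite, on `{p₀ ≥ 0}`, on the closed cone
  obtain ⟨μ', hμ'⟩ := OSReconstructionNoE1.exists_isJointSpectralMeasure_holds h ψ'
  haveI := hμ'.isFiniteMeasure
  have hae0 : ∀ᵐ p ∂μ', (0 : ℝ) ≤ p 0 := by
    rw [ae_iff]; simpa only [not_le] using hμ'.energy_nonneg
  have haec : ∀ᵐ p ∂μ', |p 1| ≤ p 0 := by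
    rw [ae_iff]; simpa only [not_le] using hcone ψ' μ' hμ'
  have hae : ∀ᵐ p ∂μ', (0 : ℝ) ≤ p 0 ∧ |p 1| ≤ p 0 := hae0.and haec
  -- index set of real points, kernel functions, their `L²` classes, and the Hilbert-space vectors
  let R : Type := {tb : ℝ × ℝ // 0 ≤ tb.1}
  let e : R → EuclideanSpace ℝ (Fin 4) → ℂ := fun r p =>
    cexp ((((-(r.1.1 * p 0)) : ℝ) : ℂ) + (((r.1.2 * p 1) : ℝ) : ℂ) * I)
  have he : ∀ r : R, MemLp (e r) 2 μ' := fun r =>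
    MemLp.of_bound (continuous_rKernel r.1.1 r.1.2).aestronglyMeasurable 1
      (by filter_upwards [hae0] with p hp using norm_rKernel_le_one r.2 r.1.2 hp)
  let E : R → Lp ℂ 2 μ' := fun r => (he r).toLp (e r)
  have hE : ∀ r : R, (E r : EuclideanSpace ℝ (Fin 4) → ℂ) =ᵐ[μ'] e r := fun r => (he r).coeFn_toLp
  let V : R → h.Hilbert := fun r =>
    h.transfer r.1.1 (h.translate (r.1.2 • EuclideanSpace.single 1 1) ψ')
  -- the Gram identity `⟪E r, E s⟫ = ⟪V r, V s⟫`
  have hgram : ∀ r s : R, ⟪E r, E s⟫_ℂ = ⟪V r, V s⟫_ℂ := by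
    intro r s
    rw [MeasureTheory.L2.inner_def, inner_transferTranslate_transferTranslate h hμ' r.2 s.2 r.1.2 s.1.2]
    refine integral_congr_ae ?_
    filter_upwards [hE r, hE s] with p hr hs
    rw [hr, hs, RCLike.inner_apply, mul_comm]
    exact conj_rKernel_mul_rKernel r.1.1 r.1.2 s.1.1 s.1.2 p
  -- linear combinations
  set ΛE : (R →₀ ℂ) →ₗ[ℂ] Lp ℂ 2 μ' := Finsupp.linearCombination ℂ E with hΛE
  set ΛV : (R →₀ ℂ) →ₗ[ℂ] h.Hilbert := Finsupp.linearCombination ℂ V with hΛV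
  have hnorm : ∀ l, ‖ΛV l‖ = ‖ΛE l‖ := by
    intro l
    have hV' : ΛV l = ∑ a ∈ l.support, l a • V a := by
      rw [hΛV, Finsupp.linearCombination_apply, Finsupp.sum]
    have hE' : ΛE l = ∑ a ∈ l.support, l a • E a := by
      rw [hΛE, Finsupp.linearCombination_apply, Finsupp.sum]
    have hinner : ⟪ΛV l, ΛV l⟫_ℂ = ⟪ΛE l, ΛE l⟫_ℂ := by
      rw [hV', hE', ← sum_sum_conj_mul_inner', ← sum_sum_conj_mul_inner']
      simp_rw [hgram]
    have h1 := inner_self_eq_norm_sq (𝕜 := ℂ) (ΛV l)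
    rw [hinner, inner_self_eq_norm_sq (𝕜 := ℂ) (ΛE l)] at h1
    have h3 : ‖ΛV l‖ ^ 2 = ‖ΛE l‖ ^ 2 := h1.symm
    exact (pow_left_inj₀ (norm_nonneg _) (norm_nonneg _) two_ne_zero).1 h3
  -- the functional `l ↦ ⟪ψ, ΛV l⟫` and its Cauchy–Schwarz bound
  set L : (R →₀ ℂ) →ₗ[ℂ] ℂ := (innerSL ℂ ψ : h.Hilbert →L[ℂ] ℂ).toLinearMap ∘ₗ ΛV with hL
  have hLapply : ∀ l, L l = ⟪ψ, ΛV l⟫_ℂ := fun l => rfl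
  have hbound : ∀ l, ‖L l‖ ≤ ‖ψ‖ * ‖ΛE l‖ := by
    intro l
    rw [hLapply, ← hnorm]
    exact norm_inner_le_norm _ _
  -- first isomorphism theorem: `L` descends to the range of `ΛE`
  have hker : LinearMap.ker ΛE ≤ LinearMap.ker L := fun l hl => by
    rw [LinearMap.mem_ker] at hl ⊢
    have := hbound l
    rw [hl, norm_zero, mul_zero] at this
    exact norm_le_zero_iff.1 this
  set L' : LinearMap.range ΛE →ₗ[ℂ] ℂ :=
    ((LinearMap.ker ΛE).liftQ L hker).comp ΛE.quotKerEquivRange.symm.toLinearMap with hL'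
  have hL'apply : ∀ l, L' ⟨ΛE l, LinearMap.mem_range_self ΛE l⟩ = L l := by
    intro l
    have hq : ΛE.quotKerEquivRange.symm ⟨ΛE l, LinearMap.mem_range_self ΛE l⟩ =
        Submodule.Quotient.mk l := by
      rw [LinearEquiv.symm_apply_eq]
      apply Subtype.ext
      rw [LinearMap.quotKerEquivRange_apply_mk]
    simp only [hL', LinearMap.comp_apply, LinearEquiv.coe_toLinearMap, hq, Submodule.liftQ_apply]
  have hL'bound : ∀ v : LinearMap.range ΛE, ‖L' v‖ ≤ ‖ψ‖ * ‖v‖ := by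
    rintro ⟨v, hv⟩
    obtain ⟨l, rfl⟩ := LinearMap.mem_range.1 hv
    rw [hL'apply l]
    exact hbound l
  set L'c : LinearMap.range ΛE →L[ℂ] ℂ := L'.mkContinuous ‖ψ‖ hL'bound with hL'c
  have hL'c_norm : ‖L'c‖ ≤ ‖ψ‖ := LinearMap.mkContinuous_norm_le _ (norm_nonneg _) _
  -- Hahn–Banach and Riesz in `L²(μ')`
  obtain ⟨gext, hgext, hgext_norm⟩ := exists_extension_norm_eq (LinearMap.range ΛE) L'c
  set g : Lp ℂ 2 μ' := (InnerProductSpace.toDual ℂ (Lp ℂ 2 μ')).symm gext with hg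
  have hg_inner : ∀ v, ⟪g, v⟫_ℂ = gext v := fun v => InnerProductSpace.toDual_symm_apply
  have hg_norm : ‖g‖ ≤ ‖ψ‖ := by
    rw [hg, LinearIsometryEquiv.norm_map, hgext_norm]; exact hL'c_norm
  have hgE : ∀ r : R, ⟪g, E r⟫_ℂ = ⟪ψ, V r⟫_ℂ := by
    intro r
    have hΛ1 : ΛE (Finsupp.single r 1) = E r := by
      rw [hΛE, Finsupp.linearCombination_single, one_smul]
    have hΛV1 : ΛV (Finsupp.single r 1) = V r := by
      rw [hΛV, Finsupp.linearCombination_single, one_smul]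
    calc ⟪g, E r⟫_ℂ = gext (E r) := hg_inner _
      _ = gext (ΛE (Finsupp.single r 1)) := by rw [hΛ1]
      _ = L'c ⟨ΛE (Finsupp.single r 1), LinearMap.mem_range_self ΛE _⟩ :=
          hgext ⟨ΛE (Finsupp.single r 1), LinearMap.mem_range_self ΛE _⟩
      _ = L (Finsupp.single r 1) := by rw [hL'c, LinearMap.mkContinuous_apply, hL'apply]
      _ = ⟪ψ, V r⟫_ℂ := by rw [hLapply, hΛV1]
  -- `g` as a function: square integrable, hence integrable (finite measure)
  have hg_int : Integrable (fun p => (g : EuclideanSpace ℝ (Fin 4) → ℂ) p) μ' :=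
    (Lp.memLp g).integrable one_le_two
  -- the function
  refine ⟨fun w => ∫ p, conj ((g : EuclideanSpace ℝ (Fin 4) → ℂ) p) *
      cexp (-(w.1 * ((p 0 : ℝ) : ℂ)) + w.2 * ((p 1 : ℝ) : ℂ) * I) ∂μ', ?_, ?_, ?_⟩
  · -- holomorphy on `D`: dominated holomorphic parameter integral on `ℂ × ℂ`
    refine Literature.Analysis.Complex.differentiableOn_integral_of_dominated
      (fun w _ => ((Lp.aestronglyMeasurable g).star.mul (continuous_cKernel w).aestronglyMeasurable))
      (Eventually.of_forall fun p => (differentiable_cKernel _ p).differentiableOn)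
      fun w₀ hw₀ => ?_
    obtain ⟨ρ, hρ, hball⟩ := Metric.isOpen_iff.1 isOpen_coneDomain w₀ hw₀
    refine ⟨ρ, hρ, hball, fun p => ‖(g : EuclideanSpace ℝ (Fin 4) → ℂ) p‖, hg_int.norm, ?_⟩
    filter_upwards [hae] with p hp
    intro w hw
    rw [norm_mul, RCLike.norm_conj]
    have := norm_cKernel_le_one (le_of_lt (hball hw)) hp.1 hp.2
    calc ‖(g : EuclideanSpace ℝ (Fin 4) → ℂ) p‖ *
          ‖cexp (-(w.1 * ((p 0 : ℝ) : ℂ)) + w.2 * ((p 1 : ℝ) : ℂ) * I)‖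
        ≤ ‖(g : EuclideanSpace ℝ (Fin 4) → ℂ) p‖ * 1 := by gcongr
      _ = ‖(g : EuclideanSpace ℝ (Fin 4) → ℂ) p‖ := mul_one _
  · -- real points
    intro t b ht
    let r : R := ⟨(t, b), ht.le⟩
    have h1 : (∫ p, conj ((g : EuclideanSpace ℝ (Fin 4) → ℂ) p) *
        cexp (-(((t : ℂ), (b : ℂ)).1 * ((p 0 : ℝ) : ℂ)) +
          ((t : ℂ), (b : ℂ)).2 * ((p 1 : ℝ) : ℂ) * I) ∂μ') = ⟪g, E r⟫_ℂ := by
      rw [MeasureTheory.L2.inner_def]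
      refine integral_congr_ae ?_
      filter_upwards [hE r] with p hp
      rw [hp, RCLike.inner_apply, cKernel_ofReal]
      exact mul_comm _ _
    show (∫ p, conj ((g : EuclideanSpace ℝ (Fin 4) → ℂ) p) *
        cexp (-(((t : ℂ), (b : ℂ)).1 * ((p 0 : ℝ) : ℂ)) +
          ((t : ℂ), (b : ℂ)).2 * ((p 1 : ℝ) : ℂ) * I) ∂μ') = _
    rw [h1, hgE r]
  · -- the bound `‖Φ w‖ ≤ ‖g‖ ‖e_w‖ ≤ ‖ψ‖ ‖ψ'‖`
    intro w hw
    have hFw : MemLp (fun p : EuclideanSpace ℝ (Fin 4) =>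
        cexp (-(w.1 * ((p 0 : ℝ) : ℂ)) + w.2 * ((p 1 : ℝ) : ℂ) * I)) 2 μ' :=
      MemLp.of_bound (continuous_cKernel w).aestronglyMeasurable 1
        (by filter_upwards [hae] with p hp using norm_cKernel_le_one (le_of_lt hw) hp.1 hp.2)
    set Fw : Lp ℂ 2 μ' := hFw.toLp _ with hFw_def
    have hFw_ae : (Fw : EuclideanSpace ℝ (Fin 4) → ℂ) =ᵐ[μ']
        fun p => cexp (-(w.1 * ((p 0 : ℝ) : ℂ)) + w.2 * ((p 1 : ℝ) : ℂ) * I) := hFw.coeFn_toLp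
    have h1 : (∫ p, conj ((g : EuclideanSpace ℝ (Fin 4) → ℂ) p) *
        cexp (-(w.1 * ((p 0 : ℝ) : ℂ)) + w.2 * ((p 1 : ℝ) : ℂ) * I) ∂μ') = ⟪g, Fw⟫_ℂ := by
      rw [MeasureTheory.L2.inner_def]
      refine integral_congr_ae ?_
      filter_upwards [hFw_ae] with p hp
      rw [hp, RCLike.inner_apply, mul_comm]
    have hFw_norm : ‖Fw‖ ≤ ‖ψ'‖ := by
      have hb := Lp.norm_le_of_ae_bound (f := Fw) zero_le_one
        (by filter_upwards [hFw_ae, hae] with p hp hp'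
            rw [hp]; exact norm_cKernel_le_one (le_of_lt hw) hp'.1 hp'.2)
      have hm : (measureUnivNNReal μ' : ℝ) = ‖ψ'‖ ^ 2 := by
        rw [← hμ'.measureReal_univ, measureReal_def]
        rfl
      rw [mul_one] at hb
      refine hb.trans (le_of_eq ?_)
      rw [hm]
      have : ((2 : ℝ≥0∞).toReal)⁻¹ = ((2 : ℕ) : ℝ)⁻¹ := by norm_num
      rw [this, Real.pow_rpow_inv_natCast (norm_nonneg _) two_ne_zero]
    show ‖∫ p, conj ((g : EuclideanSpace ℝ (Fin 4) → ℂ) p) *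
        cexp (-(w.1 * ((p 0 : ℝ) : ℂ)) + w.2 * ((p 1 : ℝ) : ℂ) * I) ∂μ'‖ ≤ ‖ψ‖ * ‖ψ'‖
    rw [h1]
    calc ‖⟪g, Fw⟫_ℂ‖ ≤ ‖g‖ * ‖Fw‖ := norm_inner_le_norm _ _
      _ ≤ ‖ψ‖ * ‖ψ'‖ := by gcongr

end Contraction

/-- **Stub 5 — TRANSFER `C⁺ ⇒ C`: the operator cone gives the typed tube statement for ALL
time-ordered pairs.** If every joint spectral measure of every vector of the OS space `h` of
`S.toLabelled` is carried by `{p₀ ≥ |p₁|}`, then for time-ordered `F` (`n` points), `G` (`m` points)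
there is `Φ` holomorphic on `{|Im β| < Re ζ}` with `Φ(t,b) = 𝔖_{n+m}(ΘF* ⊗ G_{te₀+be₁})` (any tensor
witness, `t > 0`) and `‖Φ(ζ,β)‖² ≤ ‖𝔖_{2n}(ΘF*⊗F)‖ ‖𝔖_{2m}(ΘG*⊗G)‖`. -/
theorem stub_transfer (S : SchwingerFamily E4) (h : OSReconstructionNoE1 S.toLabelled)
    (hcone : ∀ (ψ : h.Hilbert) (μ : Measure E4), h.IsJointSpectralMeasure ψ μ →
      μ {p | p 0 < |p 1|} = 0)
    (n m : ℕ) (F : 𝓢((Fin n → E4), ℂ)) (G : 𝓢((Fin m → E4), ℂ))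
    (hF : IsTimeOrdered F) (hG : IsTimeOrdered G) :
    ∃ Φ : ℂ × ℂ → ℂ, DifferentiableOn ℂ Φ {w : ℂ × ℂ | |w.2.im| < w.1.re} ∧
      (∀ (t b : ℝ), 0 < t → ∀ H : 𝓢((Fin (n + m) → E4), ℂ),
        IsAppendTensorOf H (osAdjoint F)
            (translateMulti (t • EuclideanSpace.single 0 1 + b • EuclideanSpace.single 1 1) G) →
          Φ ((t : ℂ), (b : ℂ)) = S (n + m) H) ∧
      (∀ w ∈ {w : ℂ × ℂ | |w.2.im| < w.1.re},
        ∀ (HF : 𝓢((Fin (n + n) → E4), ℂ)) (HG : 𝓢((Fin (m + m) → E4), ℂ)),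
          IsAppendTensorOf HF (osAdjoint F) F → IsAppendTensorOf HG (osAdjoint G) G →
            ‖Φ w‖ ^ 2 ≤ ‖S (n + n) HF‖ * ‖S (m + m) HG‖) := by
  -- the contraction family of `(Ψ_F, Ψ_G)`, read back as Schwinger functions
  obtain ⟨Φ, hΦd, hΦr, hΦb⟩ := Contraction.contractionFamily h hcone
    (h.fieldVec n (fun _ => ()) F hF) (h.fieldVec m (fun _ => ()) G hG)
  refine ⟨Φ, hΦd, ?_, ?_⟩
  · intro t b ht H hH
    rw [hΦr t b ht, OSReconstructionNoE1.translate_fieldVec,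
      OSReconstructionNoE1.transfer_fieldVec _ ht.le]
    have hH' : IsAppendTensorOf H (osAdjoint F) (translateMulti (SchwingerFamily.timeVec t)
        (translateMulti (spatialPart 0 (b • (EuclideanSpace.single 1 1 : E4))) G)) := by
      rw [TwoMirrorLightconeSlots.DiscSections.translateMulti_time_space]; exact hH
    rw [h.inner_fieldVec_fieldVec (fun _ => ()) (fun _ => ()) hF _ hH']
    rfl
  · intro w hw HF HG hHF hHG
    have hb := hΦb w hw
    have hsq : ∀ {k : ℕ} (A : 𝓢((Fin k → E4), ℂ)) (hA : IsTimeOrdered A)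
        (HA : 𝓢((Fin (k + k) → E4), ℂ)),
        IsAppendTensorOf HA (osAdjoint A) A →
          ‖S (k + k) HA‖ = ‖h.fieldVec k (fun _ => ()) A hA‖ ^ 2 := by
      intro k A hA HA hHA
      have e := h.inner_fieldVec_fieldVec (fun _ => ()) (fun _ => ()) hA hA hHA
      rw [show S (k + k) HA =
          ⟪h.fieldVec k (fun _ => ()) A hA, h.fieldVec k (fun _ => ()) A hA⟫_ℂ from e.symm,
        inner_self_eq_norm_sq_to_K, norm_pow, RCLike.norm_ofReal, abs_norm]
    rw [hsq F hF HF hHF, hsq G hG HG hHG, ← mul_pow]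
    exact pow_le_pow_left₀ (norm_nonneg _) hb 2

end Summit.QuantumFields.YangMills.Cruxes.PlanarSpectralCone.PositivityDiscToOperatorCone
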